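import Mathlib
import Summits.Ventures.PercRepro2.CrossSection

/-!
# The good-coordinate reduction for (AS3)
(seat mine-b, cell pub-perc-repro2; conjectures/MINE-B.md §15.2, proofs/MINE-B-CROSSSECTION.md §3)

By the cross-sectioning identity `Phi_insert` (CrossSection.lean), `Φ(insert i U′; A, B) =
Φ(U′; A, B₁) + Φ(U′; A₁, B) + D_i + E_i − N_i`; a coordinate `i` is GOOD for `(A, B)` when
`N_i ≤ D_i + E_i`.

* `AS3_of_goodCoordinate` — if every pair of increasing events on every nonempty cube either satisfies
  (AS3) outright or has a good coordinate, then (AS3) holds for every pair on every finite cube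
  (strong induction on the cube; the cross pairs `(A, B₁)`, `(A₁, B)` are not nested, which is why
  the hypothesis must range over all pairs);
* `cN_le_cE_of_pivotal_in`, `good_of_pivotal_in` — a PROVED sufficient condition: for `A ⊆ B`, if `i` is
  pivotal for `B` only through `A`-witnesses (`L ∉ B`, `L ∪ i ∈ B` ⟹ `L ∪ i ∈ A`: every minimal member
  of `B` containing `i` lies in `A`), then every doubly pivotal configuration lies in `E_i`, so `i` is good.

Census (MINE-B.md §15.2): every nested pair on ≤ 5 elements has a good coordinate, and every pair at
n = 5 except `A ∈ {⊤, {γ ≠ ∅}}` (where (AS3) is Reimer's inequality) — but NOT every pair on 6 elements: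
`A = up{134, 0234, 025, 0135, 0145, 1245, 2345} ⊆ B = up{02, 13, 23, 14, 24, 34, 05, 25}` satisfies (AS3)
with `Φ = 3` while every coordinate has `N_i − D_i − E_i = 1` (MINE-B.md §15.2 CORRECTION, NEG-B17). So the
theorem below is an induction SCHEME whose «good» branch is not always available; a proof of (AS3) along
these lines must carry the cross pairs' own slack. Nothing here depends on the census.
-/

open Finset

namespace Summit.Ventures.PercRepro2

namespace StepZero

open ReimerCube

variable {E : Type*} [DecidableEq E]

open Classical

/-! ## The good-coordinate reduction -/

/-- with no coordinates there is no (AS3) source -/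
lemma AS3_empty (A B : Finset E → Prop) : AS3 ∅ A B := by
  unfold AS3
  have h0 : ((∅ : Finset E).powerset.filter (fun γ => DOcc A B γ ∧ ¬ B (∅ \ γ))).card = 0 := by
    rw [Finset.card_eq_zero, Finset.filter_eq_empty_iff]
    intro γ hγ h
    have hγ0 : γ = ∅ := Finset.subset_empty.mp (Finset.mem_powerset.mp hγ)
    subst hγ0
    exact h.2 (by simpa using (A_and_B_of_dOcc h.1).2)
  rw [h0]
  exact Nat.zero_le _

/-- **The good-coordinate reduction.** If every pair of increasing events on every nonempty cube
either satisfies (AS3) outright or has a coordinate `i` with `N_i ≤ D_i + E_i` (a GOOD coordinate),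
then (AS3) holds for every pair of increasing events on every finite cube. -/
theorem AS3_of_goodCoordinate
    (hGC : ∀ (U : Finset E) (A B : Finset E → Prop), Incr A → Incr B → U.Nonempty →
      AS3 U A B ∨ ∃ i ∈ U, cN (U.erase i) A B i ≤ cD (U.erase i) A B i + cE (U.erase i) A B i) :
    ∀ (U : Finset E) (A B : Finset E → Prop), Incr A → Incr B → AS3 U A B := by
  intro U
  induction U using Finset.strongInduction with
  | H U ih =>
    intro A B hA hB
    rcases U.eq_empty_or_nonempty with hU | hU
    · subst hU; exact AS3_empty A B
    rcases hGC U A B hA hB hU with h | ⟨i, hi, hgood⟩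
    · exact h
    -- section at the good coordinate
    have hi' : i ∉ U.erase i := Finset.notMem_erase i U
    have hU' : insert i (U.erase i) = U := Finset.insert_erase hi
    have hsub : U.erase i ⊂ U := Finset.erase_ssubset hi
    have h1 := (AS3_iff_Phi_nonneg _ _ _).mp (ih _ hsub A (sec1 i B) hA (incr_sec1 hB i))
    have h2 := (AS3_iff_Phi_nonneg _ _ _).mp (ih _ hsub (sec1 i A) B (incr_sec1 hA i) hB)
    rw [AS3_iff_Phi_nonneg, ← hU', Phi_insert (U.erase i) hi' hA hB]
    have hg : (cN (U.erase i) A B i : ℤ) ≤ cD (U.erase i) A B i + cE (U.erase i) A B i := by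
      exact_mod_cast hgood
    linarith

/-- **A proved sufficient condition for a good coordinate** (MINE-B.md §15.2 Addendum 2): for
`A ⊆ B`, if `i` is pivotal for `B` only through `A`-witnesses — whenever `L ∉ B` and `L ∪ i ∈ B`
then `L ∪ i ∈ A` (every minimal member of `B` containing `i` lies in `A`) — then every doubly pivotal
configuration lies in `E_i`: `N_i ≤ E_i`, so `N_i ≤ D_i + E_i`. -/
theorem cN_le_cE_of_pivotal_in (U' : Finset E) {A B : Finset E → Prop} (hA : Incr A) (hB : Incr B)
    (hAB : ∀ X, A X → B X) (i : E)
    (hpiv : ∀ L : Finset E, ¬ B L → B (insert i L) → A (insert i L)) :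
    cN U' A B i ≤ cE U' A B i := by
  unfold cN cE
  apply Finset.card_le_card
  intro γ hγ
  rw [Finset.mem_filter] at hγ ⊢
  obtain ⟨hγU, hX, hnZ, hb1, hb0⟩ := hγ
  refine ⟨hγU, hX, ?_, hnZ, hb0⟩
  -- the witnesses of `A □ B₁`
  obtain ⟨K, L, hK, hL, hKL, hAK, hBL⟩ := hX
  -- `L ∉ B`, else `(K, L)` would be an `(A, B)`-pair inside `γ`
  have hLnB : ¬ B L := fun hBL' => hnZ ⟨K, L, hK, hL, hKL, hAK, fun T hT => hB hT hBL'⟩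
  -- `L ∪ i ∈ B` (the `B₁`-witness), hence `L ∪ i ∈ A`
  have hAL : A (insert i L) := hpiv L hLnB (hBL L le_rfl)
  -- `(L, K)` is an `(A₁, B)`-pair
  refine ⟨L, K, hL, hK, hKL.symm, ?_, ?_⟩
  · intro T hT
    exact hA (Finset.insert_subset_insert i hT) hAL
  · intro T hT
    exact hAB T (hAK T hT)

/-- the same, as a good coordinate -/
theorem good_of_pivotal_in (U' : Finset E) {A B : Finset E → Prop} (hA : Incr A) (hB : Incr B)
    (hAB : ∀ X, A X → B X) (i : E)
    (hpiv : ∀ L : Finset E, ¬ B L → B (insert i L) → A (insert i L)) :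
    cN U' A B i ≤ cD U' A B i + cE U' A B i :=
  le_trans (cN_le_cE_of_pivotal_in U' hA hB hAB i hpiv) (Nat.le_add_left _ _)

/-! ## The induction scheme relativised to a section-closed family of pairs -/

/-- **The good-coordinate induction inside a family.** Let `F U A B` be a family of pairs closed under the
cross sections (`F (insert i U') A B → F U' A (sec1 i B) ∧ F U' (sec1 i A) B`). If every pair of the family
on every nonempty cube either satisfies (AS3) or has a good coordinate, then (AS3) holds for every pair of
the family on every finite cube — e.g. for the STEP(0,3) pairs `(B □ B, B)` inside the family of their
cross sections (MINE-B.md §15 Addendum 10), without any hypothesis on general pairs. -/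
theorem AS3_of_goodCoordinate_family
    (F : Finset E → (Finset E → Prop) → (Finset E → Prop) → Prop)
    (hF : ∀ (U' : Finset E) (i : E) (A B : Finset E → Prop), i ∉ U' → F (insert i U') A B →
      F U' A (sec1 i B) ∧ F U' (sec1 i A) B)
    (hGC : ∀ (U : Finset E) (A B : Finset E → Prop), F U A B → Incr A → Incr B → U.Nonempty →
      AS3 U A B ∨ ∃ i ∈ U, cN (U.erase i) A B i ≤ cD (U.erase i) A B i + cE (U.erase i) A B i) :
    ∀ (U : Finset E) (A B : Finset E → Prop), F U A B → Incr A → Incr B → AS3 U A B := by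
  intro U
  induction U using Finset.strongInduction with
  | H U ih =>
    intro A B hFU hA hB
    rcases U.eq_empty_or_nonempty with hU | hU
    · subst hU; exact AS3_empty A B
    rcases hGC U A B hFU hA hB hU with h | ⟨i, hi, hgood⟩
    · exact h
    have hi' : i ∉ U.erase i := Finset.notMem_erase i U
    have hU' : insert i (U.erase i) = U := Finset.insert_erase hi
    have hsub : U.erase i ⊂ U := Finset.erase_ssubset hi
    have hFs := hF (U.erase i) i A B hi' (by rw [hU']; exact hFU)
    have h1 := (AS3_iff_Phi_nonneg _ _ _).mp (ih _ hsub A (sec1 i B) hFs.1 hA (incr_sec1 hB i))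
    have h2 := (AS3_iff_Phi_nonneg _ _ _).mp (ih _ hsub (sec1 i A) B hFs.2 (incr_sec1 hA i) hB)
    rw [AS3_iff_Phi_nonneg, ← hU', Phi_insert (U.erase i) hi' hA hB]
    have hg : (cN (U.erase i) A B i : ℤ) ≤ cD (U.erase i) A B i + cE (U.erase i) A B i := by
      exact_mod_cast hgood
    linarith

end StepZero

end Summit.Ventures.PercRepro2
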